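import Summits.BirchSwinnertonDyer.BirchSwinnertonDyer.Theorems.SchneiderFreeAdditiveX3KYMuZeroOfPrintFiveLe
import Summits.BirchSwinnertonDyer.BirchSwinnertonDyer.Theorems.SchneiderFreeAdditiveX3UpperWingField
import HarnessLib

/-!
# Route `SchneiderFreeAdditiveX3Upper` (K1 wing), crux r3 `GordTwoBranchCoIMCField`: the UPPER half of BSD_p PER PAIR on the
# (G-ord, `e = 2`) cell at `p ≥ 5` from PUBLISHED facts ∪ {Keller–Yin [DIV]} ∪ {the pair's twist-unit datum}

Cell `bsd-schneider-ideate`, seat `bsd-schneider-door-c5` (prover, generation 23; assembly layer; `--supports` 20365).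
PARTITION: board row B6 ∩ X3 ∩ sst-twist, `r = 1`, (G-ord, `e = 2`) half at `p ≥ 5` (149 of the 2 560 census pairs; class-wide
every `p ≥ 5`); types-the-object-of nothing new; re-keys the per-pair upper half to a PUBLISHED `μ`-input; closes none of B6's
cells (BSD NOT advanced).  bears_on: K1-wing (20365 r3, 20364 r2) + K1-door (19177 r3).

WHAT.  Generation 21's per-pair upper half `KYBranchOnly.missingUpperBoundAt_gordTwo_of_printedFacts_of_twistUnitAt_…` rests on
Keller–Yin's `thm351_charIdeal_eq_branch_OPEN`; generation 22 / 23 moved the wing to {[DIV], [INV.μ]} and then {[DIV], prop125}.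
At `p ≥ 5` the companion `…KYMuZeroOfPrintFiveLe` (this seat) supplies the FIELD-LOCAL co-socket from PUBLISHED facts + [DIV]
(`μ(𝔛) = 0` from CGLS 2022 Prop. 14 + the local non-anomalous clause of `…SemistableTwistLocalNonAnomalous`).  The cell's glue
`Upper.coChainMemberField_gordTwo_of_coIMCField_of_control` asks its co-socket at EVERY odd `p`; this file gives the twin
with the co-socket asked only at THE pair's prime (and field), and assembles:

* §1 `coChainMemberField_gordTwo_of_coIMCFieldAt_of_control` — the co-chain member at a field `K` from a co-socket supplied
  for the curves of the cell AT THIS `p` AND THIS `K` only (VERBATIM the cell's proof).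
* §2 **`missingUpperBoundAt_gordTwo_fiveLe_of_printedFacts_of_twistUnitAt_of_hsieh_of_lzz_of_KY_divisibility_of_prop14_of_castellaHsieh_signed`**:
  `PrintedFacts → Hsieh 2014 Thm A → LZZ 2018 → [DIV] → CGLS Prop 14 → CH signed → ∀ W p, 5 ≤ p → r_an = 1 → ClassX3 → SubGordTwo →
  Upper.TwistUnitFieldOffSliverAt W p → MissingUpperBoundAt W p` — the upper half `ord_p #Ш(E) ≤ ord_p #Ш(E)_an` per pair at
  `p ≥ 5` from PUBLISHED theorems ∪ {ONE preprint sentence: Keller–Yin 2410.23241 Thm 3.3.6 ∘ Prop 3.4.4} ∪ {the pair's twist-unit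
  certificate} — the control corner being CLOSED (`anticycControlAdditiveKF_proof`, `controlFacts_proof`).

HONEST FRAMING: composition of tree theorems, CONDITIONAL on the displayed hypotheses ([DIV] unrefereed; CGLS Prop 14 and the other
named facts are published theorems typed as facts; the twist-unit datum is a per-pair certificate, class-wide = wing r2, OPEN);
no item closed; BSD is proved for NO curve; «closes rung: none».

References: Castella–Grossi–Lee–Skinner 2022 Prop. 14 [CastellaGrossiLeeSkinner2022]; Keller–Yin arXiv:2410.23241 Thm. 3.3.6, Prop.
3.4.4 [KellerYin2024b]; Jetchev–Skinner–Wan 2017 §7.4.1 [JetchevSkinnerWan2017]; Gross–Zagier 1986 I.(6.3), (7.3); Miller 2011 Def. 1.1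
[Miller2011LMS]; this seat p662237, p663074, gen 21 p643127, gen 10 `…UpperWingField`.
-/

set_option autoImplicit false
set_option linter.dupNamespace false -- the summit namespace `…BirchSwinnertonDyer.BirchSwinnertonDyer.Theorems` (Sub = Summit, D-0017) trips it

noncomputable section

open scoped Classical NumberField

open Field NumberField IsDedekindDomain WeierstrassCurve
  Literature.NumberTheory.EllipticCurves Literature.NumberTheory.EllipticCurves.GreenbergSelmer
  Literature.NumberTheory.GaloisRepresentations Literature.NumberTheory.GaloisCohomology
  Literature.NumberTheory.EllipticCurves.ModularForms Literature.NumberTheory.EllipticCurves.Rank1Residual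
  Literature.NumberTheory.EllipticCurves.Rank1Residual.Typed
  Literature.NumberTheory.EllipticCurves.KellerYin2024 Literature.NumberTheory.EllipticCurves.CaiShuTian2014
  Summit.BirchSwinnertonDyer.Rank1Residual Summit.BirchSwinnertonDyer.Rank1Residual.Additive
  Summit.BirchSwinnertonDyer.Rank1Residual.X11b
  Summit.BirchSwinnertonDyer.Rank1Residual.X11b.AcSelmer Summit.BirchSwinnertonDyer.Rank1Residual.X11b.Halves
  Summit.BirchSwinnertonDyer.BirchSwinnertonDyer.Theorems.SchneiderFree
  Summit.BirchSwinnertonDyer.BirchSwinnertonDyer.Theorems.SchneiderFree.Upper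
  Summit.BirchSwinnertonDyer.BirchSwinnertonDyer.Theorems.SchneiderFree.KYRead
  Summit.BirchSwinnertonDyer.BirchSwinnertonDyer.Theorems.SchneiderFreeAdditiveX3
  Summit.BirchSwinnertonDyer.BirchSwinnertonDyer.Theorems.SchneiderFreeAdditiveX3.ControlDischarged
  Summit.BirchSwinnertonDyer.BirchSwinnertonDyer.Theorems.SchneiderFreeAdditiveX3.KYMuZeroOfPrint

open Literature.NumberTheory.EllipticCurves.CastellaGrossiLeeSkinner2022 (prop14_residualCharacterSelmer_finite)

-- the wing route's crux decls, by name (its `PrintedFacts` is the door's, same body)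
open Summit.BirchSwinnertonDyer.BirchSwinnertonDyer.Theses.SchneiderFreeAdditiveX3Upper

namespace Summit.BirchSwinnertonDyer.BirchSwinnertonDyer.Theorems.SchneiderFreeAdditiveX3.UpperOfPrint

/-! ### §1 The co-chain member at a field from a co-socket AT THIS PRIME AND FIELD -/

/-- **Co-chain member on the (G-ord, `e = 2`) cell at a field `K`, from a co-socket supplied for the cell's curves AT THE SAME `p` AND `K`
only.**  VERBATIM the cell's `Upper.coChainMemberField_gordTwo_of_coIMCField_of_control` (good member `W₁` of the isogeny class — isogenous,
same conductor, on the cell, `E₁(K)[p] = 0` —, control + Kolyvagin + the field-local co-socket ⟹ co-STEP L♯ at `K`), with its hypothesis `hCo`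
quantified over the curves only (the proof applies it at `(W₁, p, K)`).  CONDITIONAL on `hCtl`, `hCo`; nothing asserted about BSD.
[cite: KellerYin2024b, §3.3 ¶1 and Assumption 2.0.3 (arXiv:2410.23241 pp. 8, 14)] [cite: Mazur1978, Prop. 5.4]
[cite: JetchevSkinnerWan2017, §7.4.1] -/
theorem coChainMemberField_gordTwo_of_coIMCFieldAt_of_control
    (hKo : ∀ (N : ℕ) [NeZero N] (W : WeierstrassCurve ℚ) (K : Type) [Field K] [NumberField K],
      kolyvagin N W K)
    (hPar : nonempty_modularParametrizationData)
    (hCtl : ∀ (W : WeierstrassCurve ℚ) [W.IsElliptic] [W.IsGloballyMinimal] (p : ℕ) [Fact p.Prime],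
      W.analyticRank = 1 → p ≠ 2 → ClassX3 W p → Additive.SubSemistableTwist W p →
      AdditiveControlInputManinAt W p)
    (W : WeierstrassCurve ℚ) [W.IsElliptic] [W.IsGloballyMinimal] (p : ℕ) [Fact p.Prime]
    (hr : W.analyticRank = 1) (hp2 : p ≠ 2) (hX : ClassX3 W p) (hS : Additive.SubGordTwo W p)
    (K : Type) [Field K] [NumberField K] (hK : IsImaginaryQuadratic K)
    (hpd : ¬ (p : ℤ) ∣ NumberField.discr K)
    (hCo : ∀ (W₁ : WeierstrassCurve ℚ) [W₁.IsElliptic] [W₁.IsGloballyMinimal],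
      ClassX3 W₁ p → Additive.SubGordTwo W₁ p →
      (∃ Φ : AddSubgroup (geomTorsion W₁ (p : ℤ)), IsRationalLine W₁ p Φ ∧ ¬ LineDecompositionTrivialAt W₁ p Φ) →
        AdditiveIMCUpperBDPInputManinAtField W₁ p K) :
    ∃ (W₁ : WeierstrassCurve ℚ) (_ : W₁.IsElliptic) (_ : W₁.IsGloballyMinimal),
      IsIsogenous W W₁ ∧ W₁.conductorNorm ℤ = W.conductorNorm ℤ ∧ Additive.N10.Locus W₁ p ∧
      (∀ Q : (W₁.baseChange K).toAffine.Point, p • Q = 0 → Q = 0) ∧ AdditiveCoStepLInputManinAtField W₁ p K := by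
  have hp : p.Prime := Fact.out
  obtain ⟨W₁, hE₁, hmin₁, φ, m, -, -, hN₁, -, hred₁, hlat₁, htf₁⟩ :=
    GoodMember.exists_goodMember_of_modularParametrization hPar hp2 W hX hS K hK.1 hpd
  have hiso₁ : IsIsogenous W₁ W := ⟨φ⟩
  have hiso₁' : IsIsogenous W W₁ := hiso₁.symm_of_isElliptic
  -- `W₁` lies on the cell, with `r_an(W₁) = 1`
  have hG : TypeG W p := (subGord_iff_typeG_of_addv W p hp2 hX.2).mp hS.1
  have hadd₁ : Addv W₁ p := Addv.of_isIsogenous_of_typeG hX.2 hG hiso₁'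
  have hSG₁ : SubGord W₁ p := (subGord_iff_of_isIsogenous hp2 hX.2 hiso₁').mp hS.1
  have he₁ : semistabilityIndex W₁ p = 2 :=
    (semistabilityIndex_eq_of_isIsogenous_of_typeG_of_addv hp2 hX.2 hG hiso₁').trans hS.2
  have hX₁ : ClassX3 W₁ p := ⟨hred₁, hadd₁⟩
  have hS₁ : Additive.SubGordTwo W₁ p := ⟨hSG₁, he₁⟩
  have hr₁ : W₁.analyticRank = 1 := by rw [analyticRank_eq_of_isIsogenous' hiso₁, hr]
  have hloc₁ : Additive.N10.Locus W₁ p :=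
    (Additive.N10.locus_iff_cells W₁ p).mpr
      ((Additive.N10.cellM_or_cellGordTwo_of_classX3_of_subSemistableTwist W₁ p hp2 hX₁ (Or.inr hS₁)).elim
        Or.inl (fun h ↦ Or.inr (Or.inl h)))
  -- co-STEP L♯ at `W₁` AT THE FIELD `K`: field-local co-socket at the good member + control + Kolyvagin
  have hco : AdditiveCoStepLInputManinAtField W₁ p K :=
    additiveCoStepLInputManinAtField_of_kolyvagin_of_control_of_imcUpperField (fun N _ K _ _ ↦ hKo N W₁ K)
      (hCtl W₁ p hr₁ hp2 hX₁ (Or.inr hS₁)) (hCo W₁ hX₁ hS₁ hlat₁)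
  exact ⟨W₁, hE₁, hmin₁, hiso₁', hN₁, hloc₁, htf₁, hco⟩

/-! ### §2 The UPPER half per pair at `p ≥ 5` from published facts ∪ {[DIV]} ∪ {the twist-unit datum} -/

/-- **UPPER half per pair on the (G-ord, `e = 2`) cell at `p ≥ 5` ⇐ `PrintedFacts` ∧ Hsieh 2014 Thm. A ∧ Liu–Zhang–Zhang 2018 ∧ CGLS 2022
Prop. 14 ∧ Castella–Hsieh signed existence (ALL PUBLISHED) ∧ Keller–Yin [DIV] (Thm 3.3.6 ∘ Prop 3.4.4, ONE preprint sentence) ∧ the pair's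
twist-unit datum — NO crux, NO Keller–Yin §3.5.**  For every globally minimal `W/ℚ` with `r_an = 1`, `p ≥ 5` with `ClassX3 W p`,
`SubGordTwo W p` and `Upper.TwistUnitFieldOffSliverAt W p`: `MissingUpperBoundAt W p`.  Gen 10's glue
`Upper.missingUpperBoundAt_of_goodMemberCoStepLField_of_twistUnitFieldOffSliver` ∘ §1 ∘ the companion's field-local co-socket at `p ≥ 5`
`KYMuZeroOfPrint.additiveIMCUpperBDPInputManinAtField_of_hsieh_of_lzz_of_KY_divisibility_of_prop14_of_castellaHsieh_signed`, with the CLOSED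
control corner (`anticycControlAdditiveKF_proof`, `controlFacts_proof`, Kolyvagin from `PrintedFacts`).  CONDITIONAL; closes no item; BSD not
advanced.  [cite: CastellaGrossiLeeSkinner2022, §1.2 Prop. 14 (arXiv:2008.02571; Invent. Math. 227 (2022))]
[cite: KellerYin2024b, Thm. 3.3.6 and Prop. 3.4.4 (arXiv:2410.23241 p. 19) (preprint; hypothesis)]
[cite: JetchevSkinnerWan2017, §7.4.1 (arXiv:1512.06894 p. 30)] [cite: CastellaHsieh2018, §3.3, Def. 3.7 and Prop. 3.8] -/
theorem missingUpperBoundAt_gordTwo_fiveLe_of_printedFacts_of_twistUnitAt_of_hsieh_of_lzz_of_KY_divisibility_of_prop14_of_castellaHsieh_signed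
    (hF : PrintedFacts) (hA : Hsieh2014.thmA_exists_isHsiehLFunction_unrPeriod_anyLevel)
    (hL : LiuZhangZhang2018.thm151_thm153_modularCurve_heegnerVector_additive)
    (hDIV : thm336_divisibility_branch_OPEN) (h14 : prop14_residualCharacterSelmer_finite)
    (hCHσ : castellaHsieh2018_exists_isBranchBDPLFunction_signed) :
    ∀ (W : WeierstrassCurve ℚ) [W.IsElliptic] [W.IsGloballyMinimal] (p : ℕ) [Fact p.Prime],
      5 ≤ p → W.analyticRank = 1 → ClassX3 W p → Additive.SubGordTwo W p → Upper.TwistUnitFieldOffSliverAt W p →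
      MissingUpperBoundAt W p := by
  obtain ⟨hGZ, hKo, hGZK, hmod, hPar, hCas, hGZ73, -, -, hHP, -, -, -⟩ := hF
  have hCtl := anticycControlAdditiveKF_proof controlFacts_proof.1 controlFacts_proof.2.1 controlFacts_proof.2.2.1
    controlFacts_proof.2.2.2 hKo
  intro W _ _ p _ hp5 hr hX hG hTU
  have hp2 : p ≠ 2 := by omega
  have hpN : p ∣ W.conductorNorm ℤ := (W.dvd_conductorNorm_iff_not_hasGoodReductionAtPrime p).mpr hX.2.1
  exact Upper.missingUpperBoundAt_of_goodMemberCoStepLField_of_twistUnitFieldOffSliver hGZ hKo hGZK hmod hGZ73 hCas hHP W p hr hp2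
    hpN (fun K _ _ hK _ hpd hdK ↦ coChainMemberField_gordTwo_of_coIMCFieldAt_of_control hKo hPar hCtl W p hr hp2 hX hG K hK hpd
      fun W₁ _ _ hX₁ hS₁ hlat₁ ↦
        additiveIMCUpperBDPInputManinAtField_of_hsieh_of_lzz_of_KY_divisibility_of_prop14_of_castellaHsieh_signed hKo hPar hA hL
          hDIV h14 hCHσ hp5 hX₁ hS₁ hlat₁ K hdK) hTU

end Summit.BirchSwinnertonDyer.BirchSwinnertonDyer.Theorems.SchneiderFreeAdditiveX3.UpperOfPrint

end
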